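import Mathlib.FieldTheory.RatFunc.AsPolynomial
import Mathlib.FieldTheory.RatFunc.Degree
import Mathlib.RingTheory.DedekindDomain.AdicValuation
import Mathlib.RingTheory.DedekindDomain.FiniteAdeleRing
import Mathlib.RingTheory.IntegralClosure.IntegrallyClosed
import Mathlib.RingTheory.Algebraic.Integral
import Literature.AlgebraicGeometry.Frobenioids.GeometricFrobenioids
import HarnessLib

/-!
# Frobenioids I, Example 6.1 at THE geometric datum of the projective line: `O^×(A) = O^▷(A) = k_L^×` PROVED

Mochizuki, *The geometry of Frobenioids I: the general theory*, Kyushu J. Math. **62** (2008) 293–400,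
Example 6.1, kurims pp. 109–110 [cite: MochizukiFrdI2008, Ex. 6.1 p.110]: for `V` a proper normal geometrically
integral variety over a field `k` with function field `K`, `K̃/K` Galois, `D_K` a `K̃`-`ℚ`-Cartier set of prime
divisors, `B(L) ⊆ L^×` the rational functions on `V[L]` with zeros and poles in `D_L`, `Φ(L)` the effective Cartier
divisors supported in `D_L`: "`O^×(A) = O^▷(A) = k_L^×`, where `k_L` denotes the algebraic closure of `k` in `L`"
(p. 110, "since `V[L]` is a proper normal variety").

The cell types the data of Ex. 6.1 as the INTERFACE `GeometricDivisorData K K̃` (abc-iut-L1-t3, v4) and the quoted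
sentence as the SCHEMA `Ex61_units (k := k) Γ` over it (FACT-LIST row F-1102).  Its universal closure over the
interface is refuted (`not_forall_ex61_units`, degenerate interface data, p428068); the row is admissible AT
GEOMETRIC INSTANCES ONLY, and until now the tree held no geometric instance ("proper normal varieties are not in
Mathlib").  This file CONSTRUCTS the first one from Mathlib and PROVES the sentence there:

* `ProjLine.data k : GeometricDivisorData (RatFunc k) (RatFunc k)` — THE data of Ex. 6.1 for `V = ℙ¹_k`
  (`K = k(X)`, `K̃ = K` the trivial Galois extension, so every `Spec L ∈ Ob(D)` is `Spec K` and `V[L] = ℙ¹_k`),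
  `D_K` = ALL closed points of `ℙ¹_k` = the finite places (height-one primes of `k[X]`, Mathlib
  `IsDedekindDomain.HeightOneSpectrum`) together with `∞`; hence `B(L) = L^×` (every rational function has its
  zeros and poles in `D_L`), `Φ(L) = ℤ_{≥0}[D_L]` (on the regular curve `ℙ¹` every effective Weil divisor is
  Cartier), and `div` is THE divisor map of `ℙ¹`: `ord_v(f) = -log |f|_v` at a finite place (Mathlib's `v`-adic
  valuation) and `ord_∞(f) = deg(denominator) - deg(numerator) = -intDegree f` (`ProjLine.ord`, `ProjLine.divHom`);
  primes below = identity, ramification indices `1` (all the maps `V[L] → V[M]` are the identity of `ℙ¹_k`).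
* `ProjLine.ex61_units_data : Ex61_units (k := k) (ProjLine.data k)` — **F-1102 at this instance**: for
  `f ∈ k(X)^×`, `div(f) = 0 ↔ f` is algebraic over `k` (`↔ f ∈ k^×`: a rational function without zeros or poles
  is a unit of `k[X]`, i.e. a nonzero constant — `HeightOneSpectrum.mem_integers_of_valuation_le_one`; and `k`
  is algebraically closed in `k(X)` — an element algebraic over `k` is integral over the integrally closed `k[X]`,
  as is its inverse, `ProjLine.exists_eq_C_of_isAlgebraic`), and `div(f) ≥ 0 ⇒ div(f) = 0` (no finite poles ⇒
  `f ∈ k[X]`; then `ord_∞(f) = -deg f ≥ 0` forces `f` constant — properness of `ℙ¹`).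
* sanity (the datum is not degenerate): `ProjLine.ord_X_infty` (`X` has a simple pole at `∞`),
  `ProjLine.ord_X_spanX` (and a simple zero at the origin).

Everything is PROVED from Mathlib (`RatFunc`, Dedekind-domain adic valuations, `IsIntegrallyClosed`); no
`Prop`-valued named fact is introduced; the only definitions are the concrete datum and its components.  A FACT row
is an assumption label of the abc-iut cell, not an endorsement; nothing here bears on [IUTchIII] Cor. 3.12.
-/

noncomputable section

namespace Literature.AlgebraicGeometry.Frobenioids

open CategoryTheory IsDedekindDomain Polynomial

namespace ProjLine

variable (k : Type) [Field k]

/-- The closed points of `ℙ¹_k` = the set `D_K` of Ex. 6.1 for `V = ℙ¹_k`: `some v` a finite place (a height-one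
prime of `k[X]`), `none` the point at infinity. [cite: MochizukiFrdI2008, Ex. 6.1 p.109] -/
abbrev Point : Type := Option (HeightOneSpectrum k[X])

variable {k}

/-- The order of vanishing of a nonzero rational function at a closed point of `ℙ¹_k` ("zeroes minus poles",
Ex. 6.1 p. 109): `-log` of Mathlib's (multiplicative, `ℤᵐ⁰`-valued) `v`-adic valuation at a finite place `v`, and
`deg(denom) - deg(num) = -intDegree` at `∞`. [cite: MochizukiFrdI2008, Ex. 6.1 p.109] -/
def ord (f : (RatFunc k)ˣ) : Point k → ℤ
  | none => -RatFunc.intDegree (f : RatFunc k)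
  | some v => -WithZero.log (v.valuation (RatFunc k) (f : RatFunc k))

/-- `ord` at a finite place. [cite: MochizukiFrdI2008, Ex. 6.1 p.109] -/
@[simp] theorem ord_some (f : (RatFunc k)ˣ) (v : HeightOneSpectrum k[X]) :
    ord f (some v) = -WithZero.log (v.valuation (RatFunc k) (f : RatFunc k)) := rfl

/-- `ord` at infinity. [cite: MochizukiFrdI2008, Ex. 6.1 p.109] -/
@[simp] theorem ord_none (f : (RatFunc k)ˣ) : ord f none = -RatFunc.intDegree (f : RatFunc k) := rfl

/-- The valuation of a unit is nonzero (plumbing). [folklore] -/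
private theorem valuation_coe_ne_zero (v : HeightOneSpectrum k[X]) (f : (RatFunc k)ˣ) :
    v.valuation (RatFunc k) (f : RatFunc k) ≠ 0 :=
  (Valuation.ne_zero_iff _).mpr f.ne_zero

/-- `ord(1) = 0`. [cite: MochizukiFrdI2008, Ex. 6.1 p.109] -/
@[simp] theorem ord_one (P : Point k) : ord (1 : (RatFunc k)ˣ) P = 0 := by
  cases P with
  | none => simp
  | some v => simp

/-- `ord(fg) = ord(f) + ord(g)`. [cite: MochizukiFrdI2008, Ex. 6.1 p.109] -/
theorem ord_mul (f g : (RatFunc k)ˣ) (P : Point k) : ord (f * g) P = ord f P + ord g P := by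
  cases P with
  | none =>
    simp only [ord_none, Units.val_mul]
    rw [RatFunc.intDegree_mul f.ne_zero g.ne_zero, neg_add]
  | some v =>
    simp only [ord_some, Units.val_mul, map_mul]
    rw [WithZero.log_mul (valuation_coe_ne_zero v f) (valuation_coe_ne_zero v g), neg_add]

/-- A nonzero rational function has only finitely many zeros and poles on `ℙ¹_k` (Mathlib
`HeightOneSpectrum.Support.finite` for `f` and `f⁻¹`). [cite: MochizukiFrdI2008, Ex. 6.1 p.109] -/
theorem finite_support_ord (f : (RatFunc k)ˣ) : (Function.support (ord f)).Finite := by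
  have hfin : {v : HeightOneSpectrum k[X] | v.valuation (RatFunc k) (f : RatFunc k) ≠ 1}.Finite := by
    refine ((HeightOneSpectrum.Support.finite k[X] (f : RatFunc k)).union
      (HeightOneSpectrum.Support.finite k[X] ((f : RatFunc k)⁻¹))).subset fun v hv => ?_
    simp only [Set.mem_setOf_eq, Set.mem_union, HeightOneSpectrum.Support, map_inv₀] at hv ⊢
    rcases hv.lt_or_gt with h | h
    · exact Or.inr ((one_lt_inv₀ ((Valuation.pos_iff _).mpr f.ne_zero)).mpr h)
    · exact Or.inl h
  refine ((hfin.image some).insert none).subset fun P hP => ?_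
  cases P with
  | none => exact Set.mem_insert _ _
  | some v =>
    refine Set.mem_insert_of_mem _ ⟨v, ?_, rfl⟩
    intro h1
    exact hP (by simp [h1])

/-- **The divisor** `div(f) = Σ_P ord_P(f) · P ∈ ℤ[D_L]` of a nonzero rational function on `ℙ¹_k`.
[cite: MochizukiFrdI2008, Ex. 6.1 p.109] -/
def divFun (f : (RatFunc k)ˣ) : Point k →₀ ℤ :=
  Finsupp.ofSupportFinite (ord f) (finite_support_ord f)

/-- Coefficients of `div(f)`. [cite: MochizukiFrdI2008, Ex. 6.1 p.109] -/
@[simp] theorem divFun_apply (f : (RatFunc k)ˣ) (P : Point k) : divFun f P = ord f P := rfl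

/-- **The divisor map** `k(X)^× → ℤ[D_L]` as a monoid homomorphism ("`B → Φ^gp`", Ex. 6.1 p. 109).
[cite: MochizukiFrdI2008, Ex. 6.1 p.109] -/
def divHom : (RatFunc k)ˣ →* Multiplicative (Point k →₀ ℤ) where
  toFun f := Multiplicative.ofAdd (divFun f)
  map_one' := by
    change Multiplicative.ofAdd (divFun (1 : (RatFunc k)ˣ)) = Multiplicative.ofAdd 0
    congr 1
    ext P
    simp
  map_mul' f g := by
    change Multiplicative.ofAdd (divFun (f * g)) = Multiplicative.ofAdd (divFun f + divFun g)
    congr 1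
    ext P
    simp [ord_mul]

/-- `divHom f`, additively, is `div(f)`. [cite: MochizukiFrdI2008, Ex. 6.1 p.109] -/
@[simp] theorem toAdd_divHom (f : (RatFunc k)ˣ) : Multiplicative.toAdd (divHom f) = divFun f := rfl

/-- `div(f) = 0` iff `f` has neither zeros nor poles on `ℙ¹_k`. [cite: MochizukiFrdI2008, Ex. 6.1 p.109] -/
theorem divHom_eq_one_iff (f : (RatFunc k)ˣ) : divHom f = 1 ↔ ∀ P, ord f P = 0 := by
  constructor
  · intro h P
    have hP := DFunLike.congr_fun (congrArg Multiplicative.toAdd h) P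
    simpa using hP
  · intro h
    apply Multiplicative.toAdd.injective
    ext P
    simp [h]

/-! ### Rational functions without zeros or poles, and `k` algebraically closed in `k(X)` -/

/-- A nonzero rational function which is a unit at every finite place is a nonzero constant (it and its inverse
are integral at every height-one prime of the Dedekind domain `k[X]`, hence lie in `k[X]`; the units of `k[X]`
are the nonzero constants) — the `ℙ¹_k` case of "`O^×(A) = k_L^×`", direction `⊆`.
[cite: MochizukiFrdI2008, Ex. 6.1 p.110] -/
theorem exists_eq_C_of_forall_valuation_eq_one (f : (RatFunc k)ˣ)
    (h : ∀ v : HeightOneSpectrum k[X], v.valuation (RatFunc k) (f : RatFunc k) = 1) :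
    ∃ c : k, c ≠ 0 ∧ (f : RatFunc k) = RatFunc.C c := by
  obtain ⟨a, ha⟩ := RingHom.mem_range.mp
    (HeightOneSpectrum.mem_integers_of_valuation_le_one (R := k[X]) (RatFunc k) (f : RatFunc k)
      fun v => (h v).le)
  obtain ⟨b, hb⟩ := RingHom.mem_range.mp
    (HeightOneSpectrum.mem_integers_of_valuation_le_one (R := k[X]) (RatFunc k)
      ((f⁻¹ : (RatFunc k)ˣ) : RatFunc k) fun v => by
        rw [Units.val_inv_eq_inv_val, map_inv₀, h v, inv_one])
  have hinj : Function.Injective (algebraMap k[X] (RatFunc k)) := IsFractionRing.injective k[X] (RatFunc k)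
  have hab : a * b = 1 := hinj (by
    rw [map_mul, map_one, ha, hb, Units.val_inv_eq_inv_val, mul_inv_cancel₀ f.ne_zero])
  obtain ⟨c, hc, hca⟩ := Polynomial.isUnit_iff.mp (isUnit_iff_exists_inv.mpr ⟨b, hab⟩)
  exact ⟨c, hc.ne_zero, by rw [← ha, ← hca, RatFunc.algebraMap_C]⟩

/-- **`k` is algebraically closed in `k(X)`** (units version): a nonzero rational function algebraic over `k` is
a nonzero constant (it and its inverse are integral over `k`, hence over the integrally closed `k[X]`, so both
lie in `k[X]`) — the `ℙ¹_k` case of "`k_L` = the algebraic closure of `k` in `L`" being the constants, i.e. of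
"`O^×(A) = k_L^×`", direction `⊇`. [cite: MochizukiFrdI2008, Ex. 6.1 p.110] -/
theorem exists_eq_C_of_isAlgebraic (f : (RatFunc k)ˣ) (h : IsAlgebraic k (f : RatFunc k)) :
    ∃ c : k, c ≠ 0 ∧ (f : RatFunc k) = RatFunc.C c := by
  have hint : ∀ x : RatFunc k, IsAlgebraic k x → ∃ y : k[X], algebraMap k[X] (RatFunc k) y = x :=
    fun x hx => IsIntegrallyClosed.algebraMap_eq_of_integral (hx.isIntegral.tower_top (A := k[X]))
  obtain ⟨a, ha⟩ := hint _ h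
  obtain ⟨b, hb⟩ := hint ((f : RatFunc k)⁻¹) (IsAlgebraic.inv_iff.mpr h)
  have hinj : Function.Injective (algebraMap k[X] (RatFunc k)) := IsFractionRing.injective k[X] (RatFunc k)
  have hab : a * b = 1 := hinj (by rw [map_mul, map_one, ha, hb, mul_inv_cancel₀ f.ne_zero])
  obtain ⟨c, hc, hca⟩ := Polynomial.isUnit_iff.mp (isUnit_iff_exists_inv.mpr ⟨b, hab⟩)
  exact ⟨c, hc.ne_zero, by rw [← ha, ← hca, RatFunc.algebraMap_C]⟩

/-- A nonzero constant has no zeros or poles on `ℙ¹_k`. [cite: MochizukiFrdI2008, Ex. 6.1 p.110] -/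
theorem ord_eq_zero_of_eq_C (f : (RatFunc k)ˣ) {c : k} (hf : (f : RatFunc k) = RatFunc.C c) (P : Point k) :
    ord f P = 0 := by
  have hc : c ≠ 0 := by
    rintro rfl
    exact f.ne_zero (by rw [hf, map_zero])
  cases P with
  | none => simp [hf]
  | some v =>
    have hunit : IsUnit (Polynomial.C c) := Polynomial.isUnit_C.mpr hc.isUnit
    have hnot : Polynomial.C c ∉ v.asIdeal := fun hmem =>
      v.isPrime.ne_top (Ideal.eq_top_of_isUnit_mem _ hmem hunit)
    rw [ord_some, hf, ← RatFunc.algebraMap_C, HeightOneSpectrum.valuation_of_algebraMap,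
      HeightOneSpectrum.intValuation_eq_one_iff.mpr hnot, WithZero.log_one, neg_zero]

/-- **`O^×(A) = k_L^×` on `ℙ¹_k`, unit form**: `div(f) = 0` iff `f` is a nonzero constant.
[cite: MochizukiFrdI2008, Ex. 6.1 p.110] -/
theorem forall_ord_eq_zero_iff (f : (RatFunc k)ˣ) :
    (∀ P, ord f P = 0) ↔ ∃ c : k, c ≠ 0 ∧ (f : RatFunc k) = RatFunc.C c := by
  refine ⟨fun h => exists_eq_C_of_forall_valuation_eq_one f fun v => ?_, fun ⟨c, _, hc⟩ P =>
    ord_eq_zero_of_eq_C f hc P⟩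
  have hv := h (some v)
  rw [ord_some, neg_eq_zero] at hv
  rw [← WithZero.exp_log (valuation_coe_ne_zero v f), hv, WithZero.exp_zero]

/-- **`O^▷(A) = O^×(A)` on `ℙ¹_k`** ("since `V[L]` is proper"): a rational function with effective divisor —
no poles at the finite places and none at `∞` — is a polynomial of degree `≤ 0`, i.e. a nonzero constant.
[cite: MochizukiFrdI2008, Ex. 6.1 p.110] -/
theorem exists_eq_C_of_forall_ord_nonneg (f : (RatFunc k)ˣ) (h : ∀ P, 0 ≤ ord f P) :
    ∃ c : k, c ≠ 0 ∧ (f : RatFunc k) = RatFunc.C c := by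
  -- no finite poles: `f` is a polynomial `a`
  obtain ⟨a, ha⟩ := RingHom.mem_range.mp
    (HeightOneSpectrum.mem_integers_of_valuation_le_one (R := k[X]) (RatFunc k) (f : RatFunc k)
      fun v => by
        have hv := h (some v)
        rw [ord_some, neg_nonneg] at hv
        rw [← WithZero.exp_log (valuation_coe_ne_zero v f), ← WithZero.exp_zero, WithZero.exp_le_exp]
        exact hv)
  have ha0 : a ≠ 0 := by
    rintro rfl
    exact f.ne_zero (by rw [← ha, map_zero])
  -- no pole at `∞`: `deg a ≤ 0`
  have hdeg : a.natDegree = 0 := by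
    have hinf := h none
    rw [ord_none, ← ha, RatFunc.intDegree_polynomial, neg_nonneg] at hinf
    exact_mod_cast le_antisymm hinf (Nat.cast_nonneg _)
  refine ⟨a.coeff 0, fun h0 => ha0 ?_, ?_⟩
  · rw [Polynomial.eq_C_of_natDegree_eq_zero hdeg, h0, map_zero]
  · rw [← ha, ← RatFunc.algebraMap_C, ← Polynomial.eq_C_of_natDegree_eq_zero hdeg]

/-- Sanity: the datum is not degenerate — `X` has a simple pole at `∞` … [cite: MochizukiFrdI2008, Ex. 6.1 p.109] -/
theorem ord_X_infty : ord (Units.mk0 (RatFunc.X : RatFunc k) RatFunc.X_ne_zero) none = -1 := by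
  simp

/-- … and a simple zero at the origin (the height-one prime `(X)` of `k[X]`). [cite: MochizukiFrdI2008, Ex. 6.1 p.109] -/
theorem ord_X_spanX :
    ord (Units.mk0 (RatFunc.X : RatFunc k) RatFunc.X_ne_zero)
      (some ⟨Ideal.span {Polynomial.X}, (Ideal.span_singleton_prime Polynomial.X_ne_zero).mpr
        Polynomial.prime_X, by simp [Polynomial.X_ne_zero]⟩) = 1 := by
  rw [ord_some, Units.val_mk0, ← RatFunc.algebraMap_X, HeightOneSpectrum.valuation_of_algebraMap,
    HeightOneSpectrum.intValuation_singleton _ (Polynomial.X_ne_zero) (by rfl)]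
  simp

/-! ### The intermediate fields of `K/K` -/

/-- Over `K̃ = K` every `K`-algebra map between intermediate fields of `K/K` is the identity on underlying
elements (each intermediate field is the image of `K`) (plumbing). [folklore] -/
private theorem coe_algHom_apply {K : Type*} [Field K] {M L : IntermediateField K K} (φ : M →ₐ[K] L) (x : M) :
    ((φ x : L) : K) = (x : K) := by
  have h : ∀ (N : IntermediateField K K) (r : K), ((algebraMap K N r : N) : K) = r := fun N r => by
    rw [IntermediateField.coe_algebraMap_apply, Algebra.algebraMap_self, RingHom.id_apply]
  have hx : x = algebraMap K M (x : K) := Subtype.ext (h M x).symm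
  rw [hx, AlgHom.commutes, h L, h M]

variable (k)

/-- Units of an intermediate field `L` of `k(X)/k(X)` as units of `k(X)`. [cite: MochizukiFrdI2008, Ex. 6.1 p.109] -/
def toUnits (X : FinSubextCat (RatFunc k) (RatFunc k)) : (X.L)ˣ →* (RatFunc k)ˣ :=
  Units.map (algebraMap X.L (RatFunc k)).toMonoidHom

/-- Underlying element of `toUnits`. [cite: MochizukiFrdI2008, Ex. 6.1 p.109] -/
@[simp] theorem coe_toUnits_apply (X : FinSubextCat (RatFunc k) (RatFunc k)) (u : (X.L)ˣ) :
    ((toUnits k X u : (RatFunc k)ˣ) : RatFunc k) = ((u : X.L) : RatFunc k) := rfl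

/-- `toUnits` is compatible with every morphism of `D` (all of them are the identity of `Spec K`).
[cite: MochizukiFrdI2008, Ex. 6.1 p.109] -/
theorem toUnits_map {X Y : FinSubextCat (RatFunc k) (RatFunc k)} (σ : Y ⟶ X) (u : (X.L)ˣ) :
    toUnits k Y (Units.map (σ.toAlgHom : X.L →* Y.L) u) = toUnits k X u := by
  ext
  simp only [coe_toUnits_apply, Units.coe_map, MonoidHom.coe_coe]
  exact coe_algHom_apply σ.toAlgHom (u : X.L)

/-! ### THE geometric divisor data of `ℙ¹_k` -/

/-- **THE data of Example 6.1 for `V = ℙ¹_k`, `K̃ = K = k(X)`, `D_K` = all closed points** (so `V[L] = ℙ¹_k` for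
every `Spec L ∈ Ob(D)`): `D_L` = finite places `⊔ {∞}`; `Φ(L) = ℤ_{≥0}[D_L]` (every effective divisor on the
regular curve `ℙ¹` is Cartier; saturated; `ℚ`-Cartier with `n = 1`); `B(L) = L^×` (every rational function has
its zeros and poles among ALL points); `div` = the divisor map of `ℙ¹_k` (`divHom`); primes below = identity and
ramification `1` along the (identity) maps `V[L] → V[M]`; `D_K ≠ ∅`. [cite: MochizukiFrdI2008, Ex. 6.1 p.109] -/
def data : GeometricDivisorData (RatFunc k) (RatFunc k) where
  primeDiv _ := Point k
  Phi _ := ⊤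
  B _ := ⊤
  div X := divHom.comp ((toUnits k X).comp (⊤ : Subgroup (X.L)ˣ).subtype)
  over _ Q := Q
  ram _ _ := 1
  ram_pos _ _ := one_pos
  over_finite _ P := by
    simp only [Set.setOf_eq_eq_singleton]
    exact Set.finite_singleton P
  over_surjective _ := fun Q => ⟨Q, rfl⟩
  over_id _ _ := rfl
  ram_id _ _ := rfl
  over_comp _ _ _ := rfl
  ram_comp _ _ _ := rfl
  pull_mem _ _ _ := trivial
  map_mem _ _ _ := trivial
  div_natural σ f := by
    ext P
    simp only [MonoidHom.coe_comp, Function.comp_apply, Subgroup.coe_subtype, toAdd_divHom, divFun_apply,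
      DivisorCoeff.pull_apply, Nat.cast_one, one_mul]
    rw [toUnits_map]
  div_mem_gp X f := by
    refine ⟨Finsupp.mapRange Int.toNat (by simp) (Multiplicative.toAdd
        (divHom.comp ((toUnits k X).comp (⊤ : Subgroup (X.L)ˣ).subtype) f)), trivial,
      Finsupp.mapRange (fun n : ℤ => (-n).toNat) (by simp) (Multiplicative.toAdd
        (divHom.comp ((toUnits k X).comp (⊤ : Subgroup (X.L)ˣ).subtype) f)), trivial, ?_⟩
    ext P
    simp only [Finsupp.coe_sub, Pi.sub_apply, DivisorCoeff.toInt_apply, Finsupp.mapRange_apply]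
    exact (Int.toNat_sub_toNat_neg _).symm
  qCartier _ P := ⟨1, one_pos, trivial⟩
  sub_mem _ _ _ _ _ _ := trivial
  primeDiv_nonempty := ⟨⟨⊥⟩, ⟨none⟩⟩

/-- The divisor map of the datum on `f ∈ B(L) = L^×` is `div` of the underlying rational function.
[cite: MochizukiFrdI2008, Ex. 6.1 p.109] -/
theorem data_div_apply (X : FinSubextCat (RatFunc k) (RatFunc k)) (f : (data k).B X) :
    (data k).div X f = divHom (toUnits k X (f : (X.L)ˣ)) := rfl

/-- **F-1102 / Example 6.1 "`O^×(A) = O^▷(A) = k_L^×`" PROVED at THE geometric datum of `ℙ¹_k`**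
(`K̃ = K = k(X)`, `D_K` = all closed points): for every `Spec L ∈ Ob(D)` and `f ∈ B(L) = L^×`,
`div(f) = 0 ↔ f` is algebraic over `k` (both say `f ∈ k^×`: no zeros/poles ⇒ unit of `k[X]`; algebraic ⇒ integral
over the integrally closed `k[X]` together with `f⁻¹`), and `div(f)` effective `⇒ div(f) = 0` (a rational
function without poles on the proper curve `ℙ¹` is constant). Instance form of FACT-LIST row F-1102 (the
universal closure over the interface being refuted by degenerate data, `not_forall_ex61_units`).
[cite: MochizukiFrdI2008, Ex. 6.1 p.110] -/
theorem ex61_units_data : Ex61_units (k := k) (data k) := by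
  intro X f
  -- the underlying rational function `g ∈ k(X)^×` of `f ∈ B(L) = L^×`
  set g : (RatFunc k)ˣ := toUnits k X (f : (X.L)ˣ) with hg
  have hcoe : (((f : (X.L)ˣ) : X.L) : RatFunc k) = (g : RatFunc k) := rfl
  have key : (data k).div X f = 1 ↔ ∀ P, ord g P = 0 := divHom_eq_one_iff g
  refine ⟨?_, ?_⟩
  · -- `O^× = k_L^×`
    rw [key, forall_ord_eq_zero_iff, hcoe]
    refine ⟨fun ⟨c, _, hc⟩ => ?_, fun halg => exists_eq_C_of_isAlgebraic g halg⟩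
    rw [hc, ← RatFunc.algebraMap_eq_C]
    exact isAlgebraic_algebraMap c
  · -- `O^▷ = O^×`
    rintro ⟨D, -, hD⟩
    rw [key, forall_ord_eq_zero_iff]
    refine exists_eq_C_of_forall_ord_nonneg g fun P => ?_
    have hP := DFunLike.congr_fun hD P
    change ord g P = DivisorCoeff.toInt D P at hP
    rw [hP, DivisorCoeff.toInt_apply]
    exact Nat.cast_nonneg _

end ProjLine

end Literature.AlgebraicGeometry.Frobenioids

end
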